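import Summits.BirchSwinnertonDyer.BirchSwinnertonDyer.Theorems.AlignedTransportAtTwoMainConjectureOfRankZeroBSDAtTwoSeed
import Summits.BirchSwinnertonDyer.BirchSwinnertonDyer.Theorems.AlignedTransportAtTwoMainConjectureOfRankZeroBSDAtTwoLambda
import Summits.BirchSwinnertonDyer.Rank1Residual.Iwasawa.RankGrowthLayer
import HarnessLib

/-!
# Route `AlignedTransportAtTwo`, crux C2 `MainConjectureOfRankZeroBSDAtTwo` (stmt-BirchSwinnertonDyer-22298, the SEED):
# the λ-FORM of the seed residue ON THE SEED CELL — C2 ⟺ «Kato's λ-inequality at `2` is an equality on the seed cell»,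
# the λ-certified repair C2‴, and the cross-route reading C2 ⟺ the Eisenstein half on the seed cell

HONEST FRAMING (cell `bsd-f1-sign2`, prover seat `bsd-line-att-p5`, WIDTH-5 attach to line `birth`; BSD is NOT proved by any
of this). THEOREMS ONLY — no definition, no named fact, nothing asserted, closes nothing; every deep input is a DISPLAYED
hypothesis which is a PUBLISHED named fact of the tree, with the same letters as in the lead's file (p583329): `h17` Kato 2004
Thm. 17.4 (1)(2) AT `2`, `hGr` Greenberg 1999 Thm. 4.1 AT `2` (parity-free), `hper` the period unit at `2` (`E[2]` irreducible,
good at `2`), `hmod` modularity, `hGZK` Gross–Zagier–Kolyvagin. Sequel of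
`AlignedTransportAtTwoMainConjectureOfRankZeroBSDAtTwoLambda.lean` (datum/curve level).

WHAT IS PROVED (kernel-checked).
* §3 per seed-cell curve: `exists_neron_lift` (the Néron-normalised lift `ϖ·G`, `ϖ ∈ ℤ₂ˣ` by `hper`, has the `λ`, `μ` of
  `G`); `lambda_le_lam_of_kato` — KATO'S INEQUALITY AT `2` IN INVARIANTS, `λ(X(W/ℚ_∞)) ≤ λ(G)`;
  `lambda_eq_lam_of_mazurMainConjecture_two` — NECESSITY, MC ⟹ `λ(X) = λ(G)`; `mu_eq_zero_iff_lam_le_of_bsdp` — on a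
  BSD₂-certified seed with `μ(G) = 0`: `μ(X) = 0 ⟺ λ(G) ≤ λ(X)`; the λ-DOOR `mazurMainConjecture_two_of_bsdp_of_lam_le`
  (PRINT + seed hypotheses + «`λ(G) ≤ λ(X)`» ⟹ MC; here C2's `μ(L₂) = 0` binder IS USED — it frees the `μ`-clause of the
  Eisenstein half — whereas in the lead's `μ`-form it is idle); `mazurMainConjecture_two_of_bsdp_of_eisensteinHalf`.
* §4 cell-wide: `mainConjectureOfRankZeroBSDAtTwo_iff_seedLambdaLe` / `…Eq` — modulo PRINT, C2 ⟺ «on every seed-cell curve,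
  for the conductor-level newform, every integral lift `G` of `L₂(f,α)` and every cyclotomic dual datum, `λ(G) ≤ λ(X)`»: C2 IS
  «Kato's inequality `λ_alg ≤ λ_an` at `2` is an equality on the seed cell»; `seedMuZero_iff_seedLambdaLe` (lead's `μ`-form ⟺
  λ-form); `mainConjectureOfRankZeroBSDAtTwo_iff_seedEisensteinHalf` — C2 ⟺ the `bsd-2adic` decl
  `X5.O1.MainConjectureEisensteinDivisibilityAtTwo` on the seed cell (= crux `OrdEisensteinHalfAtTwo` of route
  ByReductionTypeAtTwo, stmt-BirchSwinnertonDyer-19272, restricted to BSD₂-certified rank-`0` seeds).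
* §5: the λ-CERTIFIED repair `mainConjectureOfRankZeroBSDAtTwo_lambdaCertified` (C2‴ = C2 + `AnalyticLambdaEq W 2 n` +
  `Iwasawa.LayerRankGEAt W 2 k n`, i.e. `λ_an ≤ rank E(ℚ_k)` at a layer of the `ℤ₂`-tower) is a THEOREM modulo PRINT — a
  second certificate door beside the lead's tower-gap C2′; it fires on seeds whose `2`-adic `L`-function has only cyclotomic
  zeros explained by Mordell–Weil growth (Greenberg Thm. 1.9).
HONEST SCOPE. The residue of C2 is unchanged and OPEN: `λ_alg = λ_an` (⟺ `μ_alg = 0`) on the seed cell — Kato's integral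
clause 17.4 (3) prints `p ≠ 2`. No certificate for a particular curve is claimed. BSD is not proved by any of this.

References: Kato, Astérisque 295 (2004), Thm. 17.4; Greenberg, LNM 1716 (1999), Thms. 1.9, 4.1, Conj. 1.11; Greenberg–Vatsal,
Invent. Math. 142 (2000), pp. 2–4, §3; Matsuno, IJNT 4 (2008), p. 420 (7); Abbes–Ullmo, Compositio 103 (1996), Thm. A.
-/

-- `….BirchSwinnertonDyer.BirchSwinnertonDyer.…` is the summit/sub-problem namespace (D-0017): dupNamespace is intended.
set_option linter.dupNamespace false
set_option autoImplicit false

noncomputable section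

open scoped Classical MatrixGroups ModularForm

open CongruenceSubgroup WeierstrassCurve Literature.NumberTheory.EllipticCurves
  Literature.NumberTheory.EllipticCurves.ModularForms
  Literature.NumberTheory.EllipticCurves.Rank1Residual
  Literature.NumberTheory.EllipticCurves.Rank1Residual.Typed
  Literature.NumberTheory.EllipticCurves.Greenberg1999
  Summit.BirchSwinnertonDyer.Rank1Residual
  Summit.BirchSwinnertonDyer.Rank1Residual.X1.MuLambda
  Summit.BirchSwinnertonDyer.Rank1Residual.X1.MuPart
  Summit.BirchSwinnertonDyer.Rank1Residual.X1.ParitySqueeze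
  Summit.BirchSwinnertonDyer.Rank1Residual.X5
  Summit.BirchSwinnertonDyer.Rank1Residual.F1Sign2
  Summit.BirchSwinnertonDyer.BirchSwinnertonDyer.Theorems.Rank1ResidualX1Defs
  Summit.BirchSwinnertonDyer.BirchSwinnertonDyer.Theorems.EisensteinShaCurrency
  Summit.BirchSwinnertonDyer.BirchSwinnertonDyer.Theorems.AlignedTransportAtTwoSeed
  Summit.BirchSwinnertonDyer.BirchSwinnertonDyer.Theorems.AlignedTransportAtTwoSeedLambda
  Summit.BirchSwinnertonDyer.BirchSwinnertonDyer.Theses.AlignedTransportAtTwo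

namespace Summit.BirchSwinnertonDyer.BirchSwinnertonDyer.Theorems.AlignedTransportAtTwoSeedLambdaCell

/-! ## §3 Per seed-cell curve: Kato's λ-inequality, its equality form, and the λ-door -/

section Curve

variable (W : WeierstrassCurve ℚ) [W.IsElliptic] [W.IsGloballyMinimal]

/-- **The Néron-normalised lift.** `W` good at `2` with `E[2]` irreducible, `f` a newform of `W` (any level), `G ∈ Λ` with
`ι G = L₂(f,α)`; PRINT: the period unit at `2` (`hper`: `Ω(W) = u·Ω⁺_f`, `|u|₂ = 1`). Then with `ϖ = u⁻¹` and `L₀ = ϖ·G ∈ Λ`: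
`ϖ·Ω(W) = Ω⁺_f`, `ι L₀ = ϖ·L₂(f,α)`, `λ(L₀) = λ(G)`, `μ(L₀) = μ(G)` (a `2`-adic unit constant changes neither invariant).
[cite: AbbesUllmo1996, Thm. A] [cite: GreenbergVatsal2000, §3, Remark 3.4] -/
theorem exists_neron_lift (hper : realPeriodRat_eq_unit_mul_plusPeriod_two) (hgood : W.HasGoodReductionAtPrime 2)
    (hirr : Irr W 2) (hord : IsOrdinaryAt W 2) {N : ℕ} [NeZero N] (f : CuspForm (Gamma0 N) 2) (hf : IsNewformOf W f)
    (G : IwasawaAlgebra 2) (hG : iwasawaToPowerSeries 2 G = padicLFunction f (unitRoot W 2 : ℚ_[2])) :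
    ∃ (ϖ : ℚ) (L₀ : IwasawaAlgebra 2), (ϖ : ℝ) * W.realPeriodRat = plusPeriod f ∧
      iwasawaToPowerSeries 2 L₀ = PowerSeries.C (ϖ : ℚ_[2]) * padicLFunction f (unitRoot W 2 : ℚ_[2]) ∧
      lam L₀ = lam G ∧ mu L₀ = mu G := by
  obtain ⟨u, hu, hΩ⟩ := hper W hgood hirr f hf
  have hΩpos : 0 < W.realPeriodRat := W.realPeriodRat_pos_holds
  have hu0 : u ≠ 0 := by
    rintro rfl
    rw [Rat.cast_zero, zero_mul] at hΩ
    exact hΩpos.ne' hΩ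
  have hG0 : G ≠ 0 := by
    intro h0
    rw [h0, map_zero] at hG
    exact padicLFunction_unitRoot_ne_zero hord hf hG.symm
  set ϖ : ℚ := u⁻¹ with hϖ_def
  have hϖ : (ϖ : ℝ) * W.realPeriodRat = plusPeriod f := by
    rw [hΩ, hϖ_def, Rat.cast_inv, ← mul_assoc, inv_mul_cancel₀ (by exact_mod_cast hu0), one_mul]
  have hϖnorm : ‖(ϖ : ℚ_[2])‖ = 1 := by
    rw [hϖ_def, Rat.cast_inv, norm_inv, hu, inv_one]
  set ϖ' : ℤ_[2] := ⟨(ϖ : ℚ_[2]), hϖnorm.le⟩ with hϖ'_def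
  have hϖ'u : IsUnit ϖ' := PadicInt.isUnit_iff.mpr (by rw [hϖ'_def]; exact hϖnorm)
  refine ⟨ϖ, PowerSeries.C ϖ' * G, hϖ, ?_, lam_C_mul_of_isUnit hϖ'u hG0, mu_C_mul_of_isUnit hϖ'u hG0⟩
  rw [map_mul, hG, iwasawaToPowerSeries, PowerSeries.map_C]
  rfl

/-- **KATO'S INEQUALITY AT `2` IN INVARIANTS: `λ(X(W/ℚ_∞)) ≤ λ(G)`** (`W` good ordinary at `2`, no rational point of order
`2`, `r_an = 0`; `f` a newform of `W` with an integral lift `G` of `L₂(f,α)`; PRINT `h17` for `f`, `hGr`, `hper`, `hGZK`):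
reading (iii) of `sha_readings_of_kato` at the Néron lift. In print; the content of C2 is the reverse inequality (§4).
[cite: Kato2004Asterisque, Thm. 17.4 (1)(2) (p. 273)] [cite: GreenbergLNM1716, Thm. 4.1 (p. 102)] -/
theorem lambda_le_lam_of_kato {N : ℕ} [NeZero N] {f : CuspForm (Gamma0 N) 2}
    (h17 : kato_divisibility_allPrimes W 2 (f := f)) (hGr : Greenberg1999.thm41_charValue_rankZero_anyPrime)
    (hper : realPeriodRat_eq_unit_mul_plusPeriod_two) (hGZK : rank_eq_analyticRank_of_analyticRank_le_one)
    (hord : IsOrdinaryAt W 2) (ht : ∀ x : ℚ, ¬ HasRationalTwoTorsionX W x) (hr : W.analyticRank = 0)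
    (hf : IsNewformOf W f) (G : IwasawaAlgebra 2)
    (hG : iwasawaToPowerSeries 2 G = padicLFunction f (unitRoot W 2 : ℚ_[2]))
    {κ : ZpExtension ℚ 2} {γ : Field.absoluteGaloisGroup ℚ} (hκ : κ.IsCyclotomic) (hγ : κ.IsTopGenerator γ)
    (hγ' : IsCyclotomicVariable 2 γ) (D : W.SelmerDualData κ γ) : D.lambda ≤ lam G := by
  have hirr : Irr W 2 := irr_two_of_forall_not_hasRationalTwoTorsionX W ht
  obtain ⟨ϖ, L₀, hϖ, hL₀, hlam, -⟩ := exists_neron_lift W hper hord.1 hirr hord f hf G hG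
  have hϖ0 : ϖ ≠ 0 := X2.varpi_ne_zero_of_isNewformOf hf hϖ
  have hL : W.entireLFunction 1 ≠ 0 := (W.analyticRank_eq_zero_iff_holds hf.hasEntireLFunction).mp hr
  obtain ⟨fX, hfX⟩ := (charIdeal_isPrincipal_holds 2 D.X).principal
  obtain ⟨-, -, -, -, h3⟩ := sha_readings_of_kato W h17 (O1.twoAdicEulerCharRankZero_zero_of_greenberg W hGr) hGZK
    hord hL hκ hγ hγ' hf D hϖ hϖ0 hfX hL₀
  rwa [hlam] at h3

/-- **NECESSITY: the `2`-adic main conjecture forces `λ(X) = λ(G)`.** `W` good ordinary at `2`, no rational point of order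
`2`, `f` the conductor-level newform with an integral lift `G` of `L₂(f,α)`; PRINT: the period unit (`hper`). If
`MazurMainConjecture W 2` then for every cyclotomic dual datum `λ(X) = λ(G)`: `char X = (g)`, `ι g = ϖ·L₂ = ι(ϖ·G)`, so
`g = ϖ·G` with `ϖ ∈ ℤ₂ˣ` and `λ(X) = λ(g) = λ(G)`. [cite: GreenbergVatsal2000, p. 2 (2) and p. 4] [cite: AbbesUllmo1996, Thm. A] -/
theorem lambda_eq_lam_of_mazurMainConjecture_two (hper : realPeriodRat_eq_unit_mul_plusPeriod_two)
    (hord : IsOrdinaryAt W 2) (ht : ∀ x : ℚ, ¬ HasRationalTwoTorsionX W x) [NeZero (W.conductorNorm ℤ)]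
    (f : CuspForm (Gamma0 (W.conductorNorm ℤ)) 2) (hf : IsNewformOf W f) (G : IwasawaAlgebra 2)
    (hG : iwasawaToPowerSeries 2 G = padicLFunction f (unitRoot W 2 : ℚ_[2])) (hMC : MazurMainConjecture W 2)
    {κ : ZpExtension ℚ 2} {γ : Field.absoluteGaloisGroup ℚ} (hκ : κ.IsCyclotomic) (hγ : κ.IsTopGenerator γ)
    (hγ' : IsCyclotomicVariable 2 γ) (D : W.SelmerDualData κ γ) : D.lambda = lam G := by
  have hirr : Irr W 2 := irr_two_of_forall_not_hasRationalTwoTorsionX W ht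
  obtain ⟨ϖ, L₀, hϖ, hL₀, hlam, -⟩ := exists_neron_lift W hper hord.1 hirr hord f hf G hG
  have hϖ0 : ϖ ≠ 0 := X2.varpi_ne_zero_of_isNewformOf hf hϖ
  haveI : Module.Finite (IwasawaAlgebra 2) D.X := D.module_finite_holds hγ
  obtain ⟨hX, g, hchar, hιg⟩ := hMC κ γ hκ hγ hγ' f hf ϖ hϖ D
  have hgL : g = L₀ := iwasawaToPowerSeries_injective 2 (hιg.trans hL₀.symm)
  subst hgL
  have hg0 : g ≠ 0 := ne_zero_of_iwasawaToPowerSeries_eq W hord hf hϖ0 hL₀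
  have hlamg : lam g = D.lambda := lam_generator_eq_lambdaInvariant D.X hX hg0 hchar
  rw [← hlamg, hlam]

/-- **The λ-form of the residue per seed and datum.** `W` good ordinary at `2`, no rational point of order `2`, `r_an = 0`,
`BSD(W,2)` (`hbsd`); `f` a newform of `W` (Kato 17.4 (1)(2) AT `2` for `f`: `h17`) with an integral lift `G` of `L₂(f,α)`
having `red G ≠ 0` (`μ(G) = 0`, the crux's analytic hypothesis); PRINT `hGr`, `hper`, `hGZK`. Then for every cyclotomic dual
datum: `μ(X) = 0 ⟺ λ(G) ≤ λ(X)`. (`BSD(W,2)` supplies both descent inequalities; part 1's `mu_eq_zero_iff_lam_le` at the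
Néron lift.) [cite: Kato2004Asterisque, Thm. 17.4 (1)(2) (p. 273)] [cite: GreenbergLNM1716, Thm. 4.1 (p. 102)]
[cite: Miller2011LMS, Def. 1.1] -/
theorem mu_eq_zero_iff_lam_le_of_bsdp {N : ℕ} [NeZero N] {f : CuspForm (Gamma0 N) 2}
    (h17 : kato_divisibility_allPrimes W 2 (f := f)) (hGr : Greenberg1999.thm41_charValue_rankZero_anyPrime)
    (hper : realPeriodRat_eq_unit_mul_plusPeriod_two) (hGZK : rank_eq_analyticRank_of_analyticRank_le_one)
    (hord : IsOrdinaryAt W 2) (ht : ∀ x : ℚ, ¬ HasRationalTwoTorsionX W x) (hr : W.analyticRank = 0)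
    (hbsd : BSDp W 2) (hf : IsNewformOf W f) (G : IwasawaAlgebra 2)
    (hG : iwasawaToPowerSeries 2 G = padicLFunction f (unitRoot W 2 : ℚ_[2])) (hred : red G ≠ 0)
    {κ : ZpExtension ℚ 2} {γ : Field.absoluteGaloisGroup ℚ} (hκ : κ.IsCyclotomic) (hγ : κ.IsTopGenerator γ)
    (hγ' : IsCyclotomicVariable 2 γ) (D : W.SelmerDualData κ γ) : D.mu = 0 ↔ lam G ≤ D.lambda := by
  have hirr : Irr W 2 := irr_two_of_forall_not_hasRationalTwoTorsionX W ht
  obtain ⟨ϖ, L₀, hϖ, hL₀, hlam, hmu⟩ := exists_neron_lift W hper hord.1 hirr hord f hf G hG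
  have hL : W.entireLFunction 1 ≠ 0 := (W.analyticRank_eq_zero_iff_holds hf.hasEntireLFunction).mp hr
  have hμ0 : mu L₀ = 0 := by rw [hmu]; exact mu_eq_zero_of_red_ne_zero hred
  haveI : Finite W.sha := (hGZK W (by rw [hr]; exact zero_le_one)).2
  obtain ⟨hlow, hup⟩ := Typed.lower_and_upper_of_missingPPartAt W 2 (Typed.missingPPartAt_of_bsdp W 2 hbsd)
  rw [← hlam]
  exact mu_eq_zero_iff_lam_le W h17 (O1.twoAdicEulerCharRankZero_zero_of_greenberg W hGr) hGZK hord hL hκ hγ hγ' hf D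
    hϖ hL₀ hμ0 hlow hup

/-- **THE λ-DOOR (per curve).** `W/ℚ` globally minimal, good ordinary at `2`, no rational point of order `2`, `r_an = 0`,
analytic `μ₂ = 0` on the even branch (`hμan`, the crux's hypothesis), `BSD(W,2)`; PRINT as in the lead's file. IF for the
conductor-level newform `f`, every integral lift `G` of `L₂(f,α)` and every cyclotomic dual datum `λ(G) ≤ λ(X)` (`hΛ`), THEN
`MazurMainConjecture W 2` (`hΛ` + `hμan` give `μ(X) = 0` at every datum; the lead's `mazurMainConjecture_two_of_bsdp_of_mu_eq_zero`
concludes). [cite: Kato2004Asterisque, Thm. 17.4 (1)(2) (p. 273)] [cite: GreenbergLNM1716, Thm. 4.1 (p. 102)] -/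
theorem mazurMainConjecture_two_of_bsdp_of_lam_le
    (h17 : ∀ [NeZero (W.conductorNorm ℤ)] (f : CuspForm (Gamma0 (W.conductorNorm ℤ)) 2),
      kato_divisibility_allPrimes W 2 (f := f))
    (hGr : Greenberg1999.thm41_charValue_rankZero_anyPrime)
    (hper : realPeriodRat_eq_unit_mul_plusPeriod_two) (hmod : nonempty_modularParametrizationData)
    (hGZK : rank_eq_analyticRank_of_analyticRank_le_one) (hord : IsOrdinaryAt W 2)
    (ht : ∀ x : ℚ, ¬ HasRationalTwoTorsionX W x) (hr : W.analyticRank = 0)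
    (hμan : ∀ ⦃N : ℕ⦄ [NeZero N] (f : CuspForm (Gamma0 N) 2), IsNewformOf W f →
      ∀ G : IwasawaAlgebra 2, IsEvenBranchLiftAtTwo W f G → red G ≠ 0)
    (hbsd : BSDp W 2)
    (hΛ : ∀ [NeZero (W.conductorNorm ℤ)] (f : CuspForm (Gamma0 (W.conductorNorm ℤ)) 2), IsNewformOf W f →
      ∀ G : IwasawaAlgebra 2, iwasawaToPowerSeries 2 G = padicLFunction f (unitRoot W 2 : ℚ_[2]) →
      ∀ (κ : ZpExtension ℚ 2) (γ : Field.absoluteGaloisGroup ℚ), κ.IsCyclotomic → κ.IsTopGenerator γ →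
        IsCyclotomicVariable 2 γ → ∀ D : W.SelmerDualData κ γ, lam G ≤ D.lambda) :
    MazurMainConjecture W 2 := by
  refine mazurMainConjecture_two_of_bsdp_of_mu_eq_zero W h17 hGr hper hmod hGZK hord ht hr hbsd ?_
  intro κ γ hκ hγ hγ' D _
  have hirr : Irr W 2 := irr_two_of_forall_not_hasRationalTwoTorsionX W ht
  haveI : NeZero (W.conductorNorm ℤ) := ⟨(W.conductorNorm_pos_holds).ne'⟩
  obtain ⟨Dm⟩ := hmod W
  have hf : IsNewformOf W Dm.f := Dm.isNewformOf
  obtain ⟨G, hG⟩ := exists_iwasawaToPowerSeries_eq_padicLFunction_two hord hf hirr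
  have hred : red G ≠ 0 := hμan Dm.f hf G (Or.inl ⟨hord, hG⟩)
  exact (mu_eq_zero_iff_lam_le_of_bsdp W (h17 Dm.f) hGr hper hGZK hord ht hr hbsd hf G hG hred hκ hγ hγ' D).mpr
    (hΛ Dm.f hf G hG κ γ hκ hγ hγ' D)

/-- **Per seed: the EISENSTEIN HALF alone gives the main conjecture** (seed hypotheses WITHOUT the analytic `μ₂ = 0`):
`X5.O1.MainConjectureEisensteinDivisibilityAtTwo W ⟹ MazurMainConjecture W 2`, by part 1 with the upper bound from `BSD(W,2)`
and Néron integrality from the period unit. [cite: Kato2004Asterisque, Thm. 17.4 (1)(2) (p. 273)]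
[cite: SkinnerUrban2014, Conj. 3.6.8 (p. 45) (shape of the Eisenstein inclusion; p odd in print)] -/
theorem mazurMainConjecture_two_of_bsdp_of_eisensteinHalf
    (h17 : ∀ [NeZero (W.conductorNorm ℤ)] (f : CuspForm (Gamma0 (W.conductorNorm ℤ)) 2),
      kato_divisibility_allPrimes W 2 (f := f))
    (hGr : Greenberg1999.thm41_charValue_rankZero_anyPrime)
    (hper : realPeriodRat_eq_unit_mul_plusPeriod_two) (hmod : nonempty_modularParametrizationData)
    (hGZK : rank_eq_analyticRank_of_analyticRank_le_one) (hord : IsOrdinaryAt W 2)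
    (ht : ∀ x : ℚ, ¬ HasRationalTwoTorsionX W x) (hr : W.analyticRank = 0) (hbsd : BSDp W 2)
    (hE : O1.MainConjectureEisensteinDivisibilityAtTwo W) : MazurMainConjecture W 2 := by
  have hirr : Irr W 2 := irr_two_of_forall_not_hasRationalTwoTorsionX W ht
  have hgo : GoodOrd W 2 := hord
  haveI : Finite W.sha := (hGZK W (by rw [hr]; exact zero_le_one)).2
  obtain ⟨-, hup⟩ := Typed.lower_and_upper_of_missingPPartAt W 2 (Typed.missingPPartAt_of_bsdp W 2 hbsd)
  exact mazurMainConjecture_two_of_eisensteinHalf_of_missingUpperBoundAt W h17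
    (fun f hf ϖ hϖ => (padicValRat_periodRatio_eq_zero_two W hper hord.1 hirr f hf ϖ hϖ).ge)
    (O1.twoAdicEulerCharRankZero_zero_of_greenberg W hGr) hGZK hmod hgo hr hE hup

end Curve

/-! ## §4 Cell-wide: C2 ⟺ «Kato's λ-inequality is an equality on the seed cell» ⟺ the Eisenstein half on the seed cell -/
section Crux

/-- **C2 ⟺ the λ-form, modulo PRINT.** Granted Kato 17.4 (1)(2) at `2` (conductor-level newforms), Greenberg 4.1, the period
unit at `2`, modularity and GZK: the crux `MainConjectureOfRankZeroBSDAtTwo` holds IF AND ONLY IF for every seed-cell curve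
`W` (non-CM, good ordinary at `2`, no rational point of order `2`, `Δ ∉ ℚ²`, `r_an = 0`, analytic `μ₂ = 0`, `BSD(W,2)`), its
conductor-level newform `f`, every `G ∈ Λ` with `ι G = L₂(f,α)` and every cyclotomic dual datum: `λ(G) ≤ λ(X(W/ℚ_∞))`.
(⇒ `lambda_eq_lam_of_mazurMainConjecture_two`; ⇐ the λ-door.) With `lambda_le_lam_of_kato`: C2 says exactly that Kato's
inequality `λ_alg ≤ λ_an` at `2` is an EQUALITY on the seed cell. [cite: Kato2004Asterisque, Thm. 17.4 (1)(2) (p. 273)]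
[cite: GreenbergLNM1716, Thm. 4.1 (p. 102) and §1 Conj. 1.11 (p. 58)] [cite: GreenbergVatsal2000, p. 4] -/
theorem mainConjectureOfRankZeroBSDAtTwo_iff_seedLambdaLe
    (h17 : ∀ (V : WeierstrassCurve ℚ) [V.IsElliptic] [V.IsGloballyMinimal] [NeZero (V.conductorNorm ℤ)]
      (f : CuspForm (Gamma0 (V.conductorNorm ℤ)) 2), kato_divisibility_allPrimes V 2 (f := f))
    (hGr : Greenberg1999.thm41_charValue_rankZero_anyPrime)
    (hper : realPeriodRat_eq_unit_mul_plusPeriod_two) (hmod : nonempty_modularParametrizationData)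
    (hGZK : rank_eq_analyticRank_of_analyticRank_le_one) :
    MainConjectureOfRankZeroBSDAtTwo ↔
      ∀ (W : WeierstrassCurve ℚ) [W.IsElliptic] [W.IsGloballyMinimal], ¬ W.HasCM →
        IsOrdinaryAt W 2 → (∀ x : ℚ, ¬ HasRationalTwoTorsionX W x) → ¬ IsSquare W.Δ →
        W.analyticRank = 0 →
        (∀ ⦃N : ℕ⦄ [NeZero N] (f : CuspForm (Gamma0 N) 2), IsNewformOf W f →
          ∀ G : IwasawaAlgebra 2, IsEvenBranchLiftAtTwo W f G → red G ≠ 0) →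
        BSDp W 2 →
        ∀ [NeZero (W.conductorNorm ℤ)] (f : CuspForm (Gamma0 (W.conductorNorm ℤ)) 2), IsNewformOf W f →
          ∀ G : IwasawaAlgebra 2, iwasawaToPowerSeries 2 G = padicLFunction f (unitRoot W 2 : ℚ_[2]) →
          ∀ (κ : ZpExtension ℚ 2) (γ : Field.absoluteGaloisGroup ℚ), κ.IsCyclotomic → κ.IsTopGenerator γ →
            IsCyclotomicVariable 2 γ → ∀ D : W.SelmerDualData κ γ, lam G ≤ D.lambda := by
  refine ⟨fun hC2 W _ _ hcm hord ht hsq hr hμan hbsd _ f hf G hG κ γ hκ hγ hγ' D => ?_,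
    fun hΛ W _ _ hcm hord ht hsq hr hμan hbsd => ?_⟩
  · exact (lambda_eq_lam_of_mazurMainConjecture_two W hper hord ht f hf G hG
      (hC2 W hcm hord ht hsq hr hμan hbsd) hκ hγ hγ' D).ge
  · exact mazurMainConjecture_two_of_bsdp_of_lam_le W (fun f => h17 W f) hGr hper hmod hGZK hord ht hr hμan hbsd
      (fun f hf G hG κ γ hκ hγ hγ' D => hΛ W hcm hord ht hsq hr hμan hbsd f hf G hG κ γ hκ hγ hγ' D)

/-- **C2 ⟺ the λ-EQUALITY form, modulo PRINT** (the other inequality is Kato's). [cite: Kato2004Asterisque, Thm. 17.4 (1)(2) (p. 273)] -/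
theorem mainConjectureOfRankZeroBSDAtTwo_iff_seedLambdaEq
    (h17 : ∀ (V : WeierstrassCurve ℚ) [V.IsElliptic] [V.IsGloballyMinimal] [NeZero (V.conductorNorm ℤ)]
      (f : CuspForm (Gamma0 (V.conductorNorm ℤ)) 2), kato_divisibility_allPrimes V 2 (f := f))
    (hGr : Greenberg1999.thm41_charValue_rankZero_anyPrime)
    (hper : realPeriodRat_eq_unit_mul_plusPeriod_two) (hmod : nonempty_modularParametrizationData)
    (hGZK : rank_eq_analyticRank_of_analyticRank_le_one) :
    MainConjectureOfRankZeroBSDAtTwo ↔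
      ∀ (W : WeierstrassCurve ℚ) [W.IsElliptic] [W.IsGloballyMinimal], ¬ W.HasCM →
        IsOrdinaryAt W 2 → (∀ x : ℚ, ¬ HasRationalTwoTorsionX W x) → ¬ IsSquare W.Δ →
        W.analyticRank = 0 →
        (∀ ⦃N : ℕ⦄ [NeZero N] (f : CuspForm (Gamma0 N) 2), IsNewformOf W f →
          ∀ G : IwasawaAlgebra 2, IsEvenBranchLiftAtTwo W f G → red G ≠ 0) →
        BSDp W 2 →
        ∀ [NeZero (W.conductorNorm ℤ)] (f : CuspForm (Gamma0 (W.conductorNorm ℤ)) 2), IsNewformOf W f →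
          ∀ G : IwasawaAlgebra 2, iwasawaToPowerSeries 2 G = padicLFunction f (unitRoot W 2 : ℚ_[2]) →
          ∀ (κ : ZpExtension ℚ 2) (γ : Field.absoluteGaloisGroup ℚ), κ.IsCyclotomic → κ.IsTopGenerator γ →
            IsCyclotomicVariable 2 γ → ∀ D : W.SelmerDualData κ γ, D.lambda = lam G := by
  refine ⟨fun hC2 W _ _ hcm hord ht hsq hr hμan hbsd _ f hf G hG κ γ hκ hγ hγ' D => ?_, fun hΛ => ?_⟩
  · exact lambda_eq_lam_of_mazurMainConjecture_two W hper hord ht f hf G hG (hC2 W hcm hord ht hsq hr hμan hbsd)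
      hκ hγ hγ' D
  · exact (mainConjectureOfRankZeroBSDAtTwo_iff_seedLambdaLe h17 hGr hper hmod hGZK).mpr
      fun W _ _ hcm hord ht hsq hr hμan hbsd _ f hf G hG κ γ hκ hγ hγ' D =>
        (hΛ W hcm hord ht hsq hr hμan hbsd f hf G hG κ γ hκ hγ hγ' D).ge

/-- **The lead's `μ`-form ⟺ this λ-form, modulo PRINT** (both ⟺ C2): on the seed cell Greenberg's `μ`-conjecture at `2` and
«Kato's λ-inequality at `2` is an equality» are the same statement. [cite: GreenbergLNM1716, §1 Conj. 1.11 (p. 58)] -/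
theorem seedMuZero_iff_seedLambdaLe
    (h17 : ∀ (V : WeierstrassCurve ℚ) [V.IsElliptic] [V.IsGloballyMinimal] [NeZero (V.conductorNorm ℤ)]
      (f : CuspForm (Gamma0 (V.conductorNorm ℤ)) 2), kato_divisibility_allPrimes V 2 (f := f))
    (hGr : Greenberg1999.thm41_charValue_rankZero_anyPrime)
    (hper : realPeriodRat_eq_unit_mul_plusPeriod_two) (hmod : nonempty_modularParametrizationData)
    (hGZK : rank_eq_analyticRank_of_analyticRank_le_one) :
    (∀ (W : WeierstrassCurve ℚ) [W.IsElliptic] [W.IsGloballyMinimal], ¬ W.HasCM →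
        IsOrdinaryAt W 2 → (∀ x : ℚ, ¬ HasRationalTwoTorsionX W x) → ¬ IsSquare W.Δ →
        W.analyticRank = 0 →
        (∀ ⦃N : ℕ⦄ [NeZero N] (f : CuspForm (Gamma0 N) 2), IsNewformOf W f →
          ∀ G : IwasawaAlgebra 2, IsEvenBranchLiftAtTwo W f G → red G ≠ 0) →
        BSDp W 2 →
        ∀ (κ : ZpExtension ℚ 2) (γ : Field.absoluteGaloisGroup ℚ), κ.IsCyclotomic →
          κ.IsTopGenerator γ → IsCyclotomicVariable 2 γ →
          ∀ D : W.SelmerDualData κ γ, D.IsTorsion → D.mu = 0) ↔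
      ∀ (W : WeierstrassCurve ℚ) [W.IsElliptic] [W.IsGloballyMinimal], ¬ W.HasCM →
        IsOrdinaryAt W 2 → (∀ x : ℚ, ¬ HasRationalTwoTorsionX W x) → ¬ IsSquare W.Δ →
        W.analyticRank = 0 →
        (∀ ⦃N : ℕ⦄ [NeZero N] (f : CuspForm (Gamma0 N) 2), IsNewformOf W f →
          ∀ G : IwasawaAlgebra 2, IsEvenBranchLiftAtTwo W f G → red G ≠ 0) →
        BSDp W 2 →
        ∀ [NeZero (W.conductorNorm ℤ)] (f : CuspForm (Gamma0 (W.conductorNorm ℤ)) 2), IsNewformOf W f →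
          ∀ G : IwasawaAlgebra 2, iwasawaToPowerSeries 2 G = padicLFunction f (unitRoot W 2 : ℚ_[2]) →
          ∀ (κ : ZpExtension ℚ 2) (γ : Field.absoluteGaloisGroup ℚ), κ.IsCyclotomic → κ.IsTopGenerator γ →
            IsCyclotomicVariable 2 γ → ∀ D : W.SelmerDualData κ γ, lam G ≤ D.lambda :=
  (mainConjectureOfRankZeroBSDAtTwo_iff_seedMuZero h17 hGr hper hmod hGZK).symm.trans
    (mainConjectureOfRankZeroBSDAtTwo_iff_seedLambdaLe h17 hGr hper hmod hGZK)

/-- **C2 ⟺ the EISENSTEIN HALF on the seed cell, modulo PRINT** (cross-route reading). Granted the same PRINT: the crux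
`MainConjectureOfRankZeroBSDAtTwo` holds IFF every seed-cell curve `W` satisfies the `bsd-2adic` cell's Eisenstein-half decl
`X5.O1.MainConjectureEisensteinDivisibilityAtTwo W` (crux `OrdEisensteinHalfAtTwo` of route ByReductionTypeAtTwo,
stmt-BirchSwinnertonDyer-19272, restricted to BSD₂-certified rank-`0` seeds). (⇒ the tree's
`mainConjectureEisensteinDivisibilityAtTwo_of_mazurMainConjecture`; ⇐ `mazurMainConjecture_two_of_bsdp_of_eisensteinHalf`.)
[cite: Kato2004Asterisque, Thm. 17.4 (1)(2) (p. 273)] [cite: SkinnerUrban2014, Conj. 3.6.8 (p. 45) (shape; p odd in print)] -/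
theorem mainConjectureOfRankZeroBSDAtTwo_iff_seedEisensteinHalf
    (h17 : ∀ (V : WeierstrassCurve ℚ) [V.IsElliptic] [V.IsGloballyMinimal] [NeZero (V.conductorNorm ℤ)]
      (f : CuspForm (Gamma0 (V.conductorNorm ℤ)) 2), kato_divisibility_allPrimes V 2 (f := f))
    (hGr : Greenberg1999.thm41_charValue_rankZero_anyPrime)
    (hper : realPeriodRat_eq_unit_mul_plusPeriod_two) (hmod : nonempty_modularParametrizationData)
    (hGZK : rank_eq_analyticRank_of_analyticRank_le_one) :
    MainConjectureOfRankZeroBSDAtTwo ↔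
      ∀ (W : WeierstrassCurve ℚ) [W.IsElliptic] [W.IsGloballyMinimal], ¬ W.HasCM →
        IsOrdinaryAt W 2 → (∀ x : ℚ, ¬ HasRationalTwoTorsionX W x) → ¬ IsSquare W.Δ →
        W.analyticRank = 0 →
        (∀ ⦃N : ℕ⦄ [NeZero N] (f : CuspForm (Gamma0 N) 2), IsNewformOf W f →
          ∀ G : IwasawaAlgebra 2, IsEvenBranchLiftAtTwo W f G → red G ≠ 0) →
        BSDp W 2 → O1.MainConjectureEisensteinDivisibilityAtTwo W := by
  refine ⟨fun hC2 W _ _ hcm hord ht hsq hr hμan hbsd => ?_, fun hE W _ _ hcm hord ht hsq hr hμan hbsd => ?_⟩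
  · exact O1.mainConjectureEisensteinDivisibilityAtTwo_of_mazurMainConjecture W fun _ =>
      hC2 W hcm hord ht hsq hr hμan hbsd
  · exact mazurMainConjecture_two_of_bsdp_of_eisensteinHalf W (fun f => h17 W f) hGr hper hmod hGZK hord ht hr hbsd
      (hE W hcm hord ht hsq hr hμan hbsd)

end Crux

/-! ## §5 The λ-CERTIFIED repair C2‴: analytic λ = Mordell–Weil growth in the `ℤ₂`-tower -/
section Certificates

variable (W : WeierstrassCurve ℚ) [W.IsElliptic] [W.IsGloballyMinimal]

/-- **Per seed: the layer-rank certificate closes the main conjecture (modulo PRINT).** λ-door hypotheses plus the TYPED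
certificates `AnalyticLambdaEq W 2 n` (`λ(ϖ·L₂(f,α)) = n`, a finite coefficient check) and `Iwasawa.LayerRankGEAt W 2 k n`
(`n ≤ rank_ℤ E(ℚ_k)`, `ℚ_1 = ℚ(√2)`): Greenberg's Thm. 1.9 (`le_lambda_of_layerRankGEAt`) gives `λ(G) = n ≤ λ(X)`.
[cite: GreenbergLNM1716, Thm. 1.9 (PDF p. 63) and Thm. 4.1 (p. 102)] [cite: Kato2004Asterisque, Thm. 17.4 (1)(2) (p. 273)] -/
theorem mazurMainConjecture_two_of_bsdp_of_layerRankGEAt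
    (h17 : ∀ [NeZero (W.conductorNorm ℤ)] (f : CuspForm (Gamma0 (W.conductorNorm ℤ)) 2),
      kato_divisibility_allPrimes W 2 (f := f))
    (hGr : Greenberg1999.thm41_charValue_rankZero_anyPrime)
    (hper : realPeriodRat_eq_unit_mul_plusPeriod_two) (hmod : nonempty_modularParametrizationData)
    (hGZK : rank_eq_analyticRank_of_analyticRank_le_one) (hord : IsOrdinaryAt W 2)
    (ht : ∀ x : ℚ, ¬ HasRationalTwoTorsionX W x) (hr : W.analyticRank = 0)
    (hμan : ∀ ⦃N : ℕ⦄ [NeZero N] (f : CuspForm (Gamma0 N) 2), IsNewformOf W f →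
      ∀ G : IwasawaAlgebra 2, IsEvenBranchLiftAtTwo W f G → red G ≠ 0)
    (hbsd : BSDp W 2) {n k : ℕ} (hlan : AnalyticLambdaEq W 2 n) (hrk : Iwasawa.LayerRankGEAt W 2 k n) :
    MazurMainConjecture W 2 := by
  refine mazurMainConjecture_two_of_bsdp_of_lam_le W h17 hGr hper hmod hGZK hord ht hr hμan hbsd ?_
  intro _ f hf G hG κ γ hκ hγ hγ' D
  have hirr : Irr W 2 := irr_two_of_forall_not_hasRationalTwoTorsionX W ht
  obtain ⟨ϖ, L₀, hϖ, hL₀, hlam, -⟩ := exists_neron_lift W hper hord.1 hirr hord f hf G hG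
  have hn : lam G = n := by rw [← hlam]; exact hlan f hf ϖ hϖ L₀ hL₀
  have hD : D.IsTorsion := (h17 f κ γ hκ hγ hγ' hord hf D).1
  rw [hn]
  exact EisensteinLowerBounds.le_lambda_of_layerRankGEAt W hrk hκ hγ D hD

/-- **The λ-CERTIFIED repair C2‴ is a theorem modulo PRINT**: C2 restricted to seeds carrying the per-curve certificates
`AnalyticLambdaEq W 2 n` and `Iwasawa.LayerRankGEAt W 2 k n` (`λ_an(W)` is Mordell–Weil growth in the `ℤ₂`-tower) — a second
door beside the lead's tower-gap `mainConjectureOfRankZeroBSDAtTwo_certified`; every binder of C2 kept verbatim. HONEST SCOPE: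
fires only where all zeros of `L₂` are cyclotomic and carried by rational points; NOT claimed class-wide.
[cite: GreenbergLNM1716, Thm. 1.9 (PDF p. 63)] [cite: Kato2004Asterisque, Thm. 17.4 (1)(2) (p. 273)] -/
theorem mainConjectureOfRankZeroBSDAtTwo_lambdaCertified
    (h17 : ∀ (V : WeierstrassCurve ℚ) [V.IsElliptic] [V.IsGloballyMinimal] [NeZero (V.conductorNorm ℤ)]
      (f : CuspForm (Gamma0 (V.conductorNorm ℤ)) 2), kato_divisibility_allPrimes V 2 (f := f))
    (hGr : Greenberg1999.thm41_charValue_rankZero_anyPrime)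
    (hper : realPeriodRat_eq_unit_mul_plusPeriod_two) (hmod : nonempty_modularParametrizationData)
    (hGZK : rank_eq_analyticRank_of_analyticRank_le_one) :
    ∀ (W : WeierstrassCurve ℚ) [W.IsElliptic] [W.IsGloballyMinimal], ¬ W.HasCM →
      IsOrdinaryAt W 2 → (∀ x : ℚ, ¬ HasRationalTwoTorsionX W x) → ¬ IsSquare W.Δ →
      W.analyticRank = 0 →
      (∀ ⦃N : ℕ⦄ [NeZero N] (f : CuspForm (Gamma0 N) 2), IsNewformOf W f →
        ∀ G : IwasawaAlgebra 2, IsEvenBranchLiftAtTwo W f G → red G ≠ 0) →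
      BSDp W 2 → (∃ n k : ℕ, AnalyticLambdaEq W 2 n ∧ Iwasawa.LayerRankGEAt W 2 k n) →
      MazurMainConjecture W 2 := by
  intro W _ _ _ hord ht _ hr hμan hbsd hcert
  obtain ⟨n, k, hlan, hrk⟩ := hcert
  exact mazurMainConjecture_two_of_bsdp_of_layerRankGEAt W (fun f => h17 W f) hGr hper hmod hGZK hord ht hr hμan hbsd
    hlan hrk

end Certificates

end Summit.BirchSwinnertonDyer.BirchSwinnertonDyer.Theorems.AlignedTransportAtTwoSeedLambdaCell

end
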